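import Literature.AlgebraicGeometry.HodgeTheory.PicardLefschetzDataTransport
import Literature.AlgebraicGeometry.HodgeTheory.UniversalHypersurfaceFlatCoefficient
import Literature.AlgebraicGeometry.HodgeTheory.UniversalHypersurfaceFibreCoordinates
import HarnessLib

/-!
# Picard–Lefschetz data along a leash, and pull-backs pinned by homogeneous coordinates (programme «PL2-MERIDIANS»)

Family `hodge`, layer `Literature/AlgebraicGeometry/HodgeTheory`. Theorems only. Written by the prover seat
`hodge-nonav-20241-p1` (g18, cell `hodge-nonav`) for the registry binder hPL₂exch = `picardLefschetz_exchangedPair`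
(crux K1-B, stmt-HodgeConjecture-19716).

* `IsPicardLefschetzData.exists_of_leash` — Picard–Lefschetz data `(δ; c₀)` for a loop `μ` at `s₀` (with an
  ARBITRARY coefficient `c₀`, e.g. the per-pencil coefficient of `picardLefschetz_oneNode`) yield data `(δ′; c′)` for
  the conjugate loop `α·μ·α⁻¹` at the other end `x` of any leash `α : x ⤳ s₀`: rescale the tree's FLAT coefficient
  (`exists_isFlatCoefficient`, `IsFlatCoefficient.const_mul`) so that its value at `s₀` is `c₀`, then transport
  (`IsPicardLefschetzData.exists_transport`).
* `pull_eq_of_fibrePoint_eq` — two endomorphisms of a fibre `Y_s` of the universal family which act in the same way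
  on homogeneous coordinates (`fibrePoint`) have the same pull-back on `Hᵏ(Y_s(ℂ); ℚ)` (the pull-back only sees the
  map on complex points, and `fibrePoint` is injective) — so the exchange clause of `picardLefschetz_exchangedPair`,
  quantified over ALL `σ′` acting as `[z] ↦ [a • z]`, follows from one such `σ′`.

## References

* [VoisinHodgeII2003] C. Voisin, Hodge Theory and Complex Algebraic Geometry II, CUP 2003, §3.2.1 Thm. 3.16,
  §3.2.2, §3.1.2 (transport of vanishing cycles along paths).
* [SerreGAGA1956] J.-P. Serre, GAGA, Ann. Inst. Fourier 6 (1956), §2 n°5.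
-/

noncomputable section

open CategoryTheory
open Literature.AlgebraicTopology.SingularHomology
open Literature.AlgebraicGeometry.Motives Literature.AlgebraicGeometry.Motives.UniversalHypersurface
open Literature.AlgebraicGeometry.HodgeTheory.UniversalHypersurface

namespace Literature.AlgebraicGeometry.HodgeTheory

variable {n d : ℕ} {hn : 1 ≤ n} {hd : 1 ≤ d} {hU : IsCohomologicallyLocallyTrivialOn (family ℂ n d) Set.univ}

/-- **Picard–Lefschetz data along a leash.** Data `(δ; c₀)` for a loop `μ` at `s₀`, with any coefficient `c₀`, give
data `(δ′; c′)` for the conjugate loop `(α·μ)·α⁻¹` at `x`, for every path `α` from `x` to `s₀`.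
[cite: VoisinHodgeII2003, §3.2.2 and §3.2.1 Thm. 3.16] -/
theorem IsPicardLefschetzData.exists_of_leash {k : ℕ} {s₀ x : ComplexPoints (base ℂ n d)} {μ : Path s₀ s₀}
    {δ : Fin k → bettiCohomology (fiberOver (family ℂ n d) s₀) n} {c₀ : ℚ}
    (h : IsPicardLefschetzData n d k hn hd hU μ δ c₀) (α : Path x s₀) :
    ∃ (δ' : Fin k → bettiCohomology (fiberOver (family ℂ n d) x) n) (c' : ℚ),
      IsPicardLefschetzData n d k hn hd hU ((α.trans μ).trans α.symm) δ' c' := by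
  obtain ⟨c, hc⟩ := exists_isFlatCoefficient n d hn hd hU
  have hc0 : c₀ ≠ 0 := h.1
  set c' : ComplexPoints (base ℂ n d) → ℚ := fun s => (c₀ / c s₀) * c s with hc'def
  have hc' : IsFlatCoefficient n d hn hd hU c' := hc.const_mul (div_ne_zero hc0 (hc.1 s₀))
  have hcs₀ : c' s₀ = c₀ := by
    rw [hc'def]; dsimp only; rw [div_mul_cancel₀ _ (hc.1 s₀)]
  have h' : IsPicardLefschetzData n d k hn hd hU μ δ (c' s₀) := by rw [hcs₀]; exact h
  obtain ⟨δ', hδ'⟩ := h'.exists_transport hc' α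
  exact ⟨δ', c' x, hδ'⟩

/-- **Pull-backs are pinned by homogeneous coordinates**: two endomorphisms of the fibre `Y_s` acting identically on
`fibrePoint` coincide on complex points, hence induce the same pull-back on rational cohomology.
[cite: SerreGAGA1956, §2 n°5 Lemme 1 b)] -/
theorem pull_eq_of_fibrePoint_eq {s : ComplexPoints (base ℂ n d)}
    (σ σ₀ : fiberOver (family ℂ n d) s ⟶ fiberOver (family ℂ n d) s)
    (h : ∀ x, fibrePoint n d s (AlgPoints.map σ x) = fibrePoint n d s (AlgPoints.map σ₀ x)) (k : ℕ) :
    BettiUniverse.pull σ k = BettiUniverse.pull σ₀ k := by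
  have hmap : AlgPoints.mapContinuous (L := ℂ) σ = AlgPoints.mapContinuous (L := ℂ) σ₀ :=
    ContinuousMap.ext fun x => by
      rw [AlgPoints.mapContinuous_apply, AlgPoints.mapContinuous_apply]
      exact fibrePoint_injective s (h x)
  change (bettiCohomology.map σ k).hom = (bettiCohomology.map σ₀ k).hom
  unfold bettiCohomology.map
  rw [hmap]

end Literature.AlgebraicGeometry.HodgeTheory

end
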